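import Mathlib

/-!
# Tier7/Line3/NumeratorNorm — the norm of the numerator ideal of `x ∈ K` is the denominator's norm times the archimedean size
(seat t7-x1, gen 4; the `size ↔ ideal-norm` link announced at STATUS ll. 15969 / 15971 — the product formula)

LINE 3 (t7-plan-3), version (ii). SplitFactorProduct bounds the split-place product by `C² (N(I γ) N(J γ))^ε` for the
ideals `I γ, J γ` whose multiplicities bound the box counts (the numerator ideals of `κ(γ)`, `κ(γ) − 1` once the
denominator is cleared), while DominantSideOfKappa's dominance uses the ARCHIMEDEAN size of `κ(γ)`. The product formula
links the two: for `x ∈ K` with `m x = a ∈ 𝓞 K` (`m ∈ 𝓞 K` a common denominator — on the support `κ(γ) ∈ κ₀ + M⁻¹𝓞`, so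
`m = M` works for `κ(γ)` and for `κ(γ) − 1`),
`N(a) = |N_{K/ℚ}(m)| · ∏_{w | ∞} (w x)^{mult w}` (`absNorm_span_eq`: `Ideal.absNorm_span_singleton`, `Algebra.coe_norm_int`,
`InfinitePlace.prod_eq_abs_norm`), hence `N(a) ≤ |N(m)| · ∏_{w | ∞} (1 + w x)^{mult w}` (`absNorm_span_le`) — the right-hand
product is the archimedean size `∏_w (1 + |x|_w)` of ProductFormulaSeparation p666471 / DominantSideOfKappa's `size` (at a
place where `|x|_w ≤ 1`, e.g. the definite place of the dictionary, the factor is `≤ 2`). DICTIONARY (in words): `K = E⁺`,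
`x = κ(γ)` resp. `κ(γ) − 1`, `m = M` the fixed denominator of the support (hout / hcong), `I γ = span {a}`; the comparison
of `∏_w (1 + |x|_w)^{mult}` with the dominance `size` (which carries the (1,1)-places only) is the definite-place bound
`|κ|_{ι₁} ≤ 1` (KappaDefiniteBound p666869), in words. Nothing here is about (N), (P), the real `X`, or HC_CM; §8(d): NO.
Blind lane: Mathlib only; no sorry; axioms ⊆ {propext, Classical.choice, Quot.sound}.
-/

namespace Summit.Ventures.HodgeRepro2.Tier7.Line3.NumeratorNorm

open NumberField
open scoped NumberField

variable {K : Type*} [Field K] [NumberField K]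

/-- the absolute norm of a principal ideal of `𝓞 K`, as a real number, is the absolute value of the field norm. -/
theorem absNorm_span_eq_abs_norm (a : 𝓞 K) :
    (Ideal.absNorm (Ideal.span {a}) : ℝ) = ((|Algebra.norm ℚ (a : K)| : ℚ) : ℝ) := by
  rw [Ideal.absNorm_span_singleton, Nat.cast_natAbs, Int.cast_abs, ← Algebra.coe_norm_int a, Rat.cast_abs,
    Rat.cast_intCast]

/-- **the norm of the numerator ideal is the denominator's norm times the archimedean size**: for `x ∈ K` with
`m x = a ∈ 𝓞 K`, `N(a) = |N(m)| · ∏_{w | ∞} (w x)^{mult w}` (the product formula, archimedean half). -/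
theorem absNorm_span_eq (x : K) (a m : 𝓞 K) (h : (a : K) = (m : K) * x) :
    (Ideal.absNorm (Ideal.span {a}) : ℝ) =
      ((|Algebra.norm ℚ (m : K)| : ℚ) : ℝ) * ∏ w : InfinitePlace K, w x ^ w.mult := by
  rw [absNorm_span_eq_abs_norm, h, map_mul, abs_mul, Rat.cast_mul, InfinitePlace.prod_eq_abs_norm]

/-- **the numerator's norm is bounded by the denominator's norm times the archimedean size `∏ (1 + |x|_w)^{mult}`.** -/
theorem absNorm_span_le (x : K) (a m : 𝓞 K) (h : (a : K) = (m : K) * x) :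
    (Ideal.absNorm (Ideal.span {a}) : ℝ) ≤
      ((|Algebra.norm ℚ (m : K)| : ℚ) : ℝ) * ∏ w : InfinitePlace K, (1 + w x) ^ w.mult := by
  rw [absNorm_span_eq x a m h]
  apply mul_le_mul_of_nonneg_left _ (by positivity)
  apply Finset.prod_le_prod
  · intro w _
    exact pow_nonneg (apply_nonneg w x) _
  · intro w _
    exact pow_le_pow_left₀ (apply_nonneg w x) (le_add_of_nonneg_left (zero_le_one' ℝ)) _

end Summit.Ventures.HodgeRepro2.Tier7.Line3.NumeratorNorm
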